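import Summits.BirchSwinnertonDyer.Rank1Residual.P2.CongruentNumberPairsAtTwoEvenAtlasThreeTransfer
import HarnessLib

/-!
# Sub-lane «bsd-p2»: the EVEN `ω(m) = 3` ATLAS, file 3/3 — DOOR B6 on the `128` LOUD configurations as
# ONE theorem, «`s(n) = 1` ∧ `Σ₂′` even ⟺ one of the 13 registered keys», and the SENTENCES: the even
# C-P2-2 clause at `ℓ = 3` in genus currency ⟺ in key currency; the EVEN RUNG THREE of the uniform law
# is EXACTLY the key sentence

HONEST FRAMING (sub-lane «bsd-p2», run/shared/lean/b2b/bsd-rank1-residual/p2/, verbatim in every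
file): the target of record is the FULL Birch–Swinnerton-Dyer formula for EVERY analytic-rank `≤ 1`
`E/ℚ` at ALL primes INCLUDING `2`; the odd-prime class ledger is referee A's; the `2`-part is OPEN
(cells O1 = X5 ∖ CM and O12 = the CM corner) and under census by «bsd-p2». Census / instrument
output at `2` = EVIDENCE / conjecture items with held-out validation, NEVER a Literature fact;
certificates close PAIRS (one isogeny class, `p = 2`), never classes. This file asserts NO
arithmetic fact: §4 is DOOR B6 (`…_of_genusPointData_six`, U⁺ discharged) restated on configurations,
modulo the displayed facts `hTYZ`, `hGZK`, `hMe` (Monsky 1994 even), `hR` (Rédei–Reichardt); §5 relates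
SENTENCES — the even C-P2-2 clause at `ℓ = 3` in genus currency (typer GEN 16 draft (P1)
`CongruentSilentEvenThreePrimesBSDTwo` = GEN 20's `CongruentSilentEvenBSDTwoAt 3`) and the `k = 3` rung of
the uniform even law (GEN 20's `CongruentEvenBSDTwoAt 3`), both stated INLINE verbatim (no unlanded
import), to the explicit-key sentence on `silentEvenCfg`; a conjecture is neither assumed nor proved.
Nothing booked; no mark moved; the even `ℓ = 3` regime is PT16A / PT16B's SCORED one — no `ℓ = 4` object
occurs. Unit `b2b-bsdres-p2-typer`: typer GEN 23 scratch @80265c5d090aceae (T-164 rails); LANDED on p2-lead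
GEN 12's WAKE-T-167 ORDER 3 (iii) as amended by p2-lead GEN 18 (ADDENDA 3, 5, 6), bytes pre-read by p2-ref GEN 73
(`p2/REFEREE.md` l.574); this provenance sentence refreshed before filing by T-199 (p2-typer GEN 66,
`p2/typer/cn/refresh_docstring_t199.py`), Lean terms unchanged.

WHAT IT GIVES. (§4) `monskySelmerRankEven_eq_one_of_silent` (no named fact);
`selmerRankOne_and_even_genusSum₂'_iff_silent` (mod `hR`): «`s(n) = 1 ∧ Σ₂′(n)` even ⟺ `silentEvenCfg`»;
`rankOne_sha_bsdp_two_congruentNumberCurve_two_mul_three_of_not_silent`: distinct primes,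
`2p₀p₁p₂ ≡ 6 (mod 8)`, `s = 1`, configuration NOT a silent key ⟹ `r_an = 1`, rank `1`, `Ш[2^∞] = 0`,
`BSD(E_n, 2)` (mod `hTYZ hGZK hMe hR`). (§5) `congruentSilentEvenThree_iff_keys` (mod `hR`) and
`evenRung_three_iff_keys` (⟹ with NO fact, ⟸ mod `hTYZ hGZK hMe hR`) — the even twin of typer GEN 22's
`oddRung_three_iff_silentFiveSevenSeven`: below the blind line BOTH rung-three statements of the uniform
Monsky laws are EXACTLY their registered conjecture clauses, in elementary currency.

References: [HeathBrown1994SelmerCongruentII] Appendix (Monsky), typescript p. 41 L20–L36;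
[TianYuanZhang2017] Thm 1.2, Thm 3.5, §1 (1.1); [LiMa2008] Thm 0.4; [Miller2011LMS] Def 1.1;
[HardyWright2008] §5.2; HOME/p2/STRUCTURE-p2.md §7; typer memos T145 (A), GEN20-EVEN-CP22-DRAFT-V2 §B,
GEN22-ODD-RUNGS §D, GEN23-EVEN-ATLAS-THREE.
-/

noncomputable section

open scoped Classical

open Matrix Finset NumberField WeierstrassCurve Literature.NumberTheory.EllipticCurves
  Literature.NumberTheory.EllipticCurves.Rank1Residual
  Literature.NumberTheory.EllipticCurves.Rank1Residual.Typed
  Literature.NumberTheory.EllipticCurves.HeathBrown1994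
  Literature.NumberTheory.EllipticCurves.HeathBrown1994.Families
  Literature.NumberTheory.EllipticCurves.TianYuanZhang2017
  Literature.NumberTheory.EllipticCurves.Tian2014
  Literature.NumberTheory.QuadraticFields.RedeiReichardt

set_option autoImplicit false

namespace Summit.BirchSwinnertonDyer.Rank1Residual.P2

/-! ## §4 DOOR B6 in configuration currency: the `128` LOUD configurations as ONE theorem -/

section Door

variable (p : Fin 3 → ℕ)

/-- No prime of a triple with `2p₀p₁p₂ ≡ 6 (mod 8)` is `2`. [cite: HardyWright2008, §5.2 (residues)] -/
theorem ne_two_of_two_mul_prod_mod_eight_six (h8 : (2 * ∏ i, p i) % 8 = 6) (i : Fin 3) : p i ≠ 2 := by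
  intro hi
  obtain ⟨t, ht⟩ : p i ∣ ∏ j, p j := Finset.dvd_prod_of_mem p (Finset.mem_univ i)
  rw [hi] at ht
  omega

/-- The residue product of such a triple is `≡ 3 (mod 4)`. [cite: HardyWright2008, §5.2 (residues)] -/
theorem cfg_prod_mod_four_of_two_mul (h8 : (2 * ∏ i, p i) % 8 = 6) :
    (p 0 % 8 * (p 1 % 8) * (p 2 % 8)) % 4 = 3 := by
  rw [Fin.prod_univ_three] at h8
  have h := mod_eight_mul_three (p 0) (p 1) (p 2)
  omega

/-- **A SILENT KEY HAS `s(n) = 1`** (no named fact): for distinct primes with `2p₀p₁p₂ ≡ 6 (mod 8)` whose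
configuration is a registered silent key, Monsky's even Selmer rank is `1` (census
`card_ker_of_silentEvenCfg` + transfer). [cite: HeathBrown1994SelmerCongruentII, Appendix (Monsky), typescript p. 41 L20–L36] -/
theorem monskySelmerRankEven_eq_one_of_silent (hp : ∀ i, (p i).Prime) (hinj : Function.Injective p)
    (h8 : (2 * ∏ i, p i) % 8 = 6)
    (hs : silentEvenCfg (fun i => p i % 8) (fun a b => kroneckerBit (p b) (p a)) = true) :
    monskySelmerRankEven p = 1 := by
  have hp2 := ne_two_of_two_mul_prod_mod_eight_six p h8
  obtain ⟨r₀, r₁, r₂, ⟨e₀, e₁, e₂⟩, hRfun, hBfun⟩ := cfg_three_eq_betaOf p hp hp2 hinj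
  have h4 : (r₀.val * r₁.val * r₂.val) % 4 = 3 := by
    rw [e₀, e₁, e₂]; exact cfg_prod_mod_four_of_two_mul p h8
  rw [hRfun, hBfun] at hs
  rw [monskySelmerRankEven_eq_one_iff_card_ker, card_ker_monskyMatrixEven_eq_cfg p hp hp2 hinj, hRfun,
    hBfun]
  exact card_ker_of_silentEvenCfg r₀ r₁ r₂ _ _ _ h4 hs

/-- **«`s(n) = 1` ∧ `Σ₂′(n)` EVEN» ⟺ «one of the 13 registered silent keys»** (mod Rédei–Reichardt), for
distinct primes with `n = 2p₀p₁p₂ ≡ 6 (mod 8)` — the SILENT cells of TYZ Thm 1.2 / DOOR B6 at even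
`ω(m) = 3` are EXACTLY the registered families (census `evenSigmaCfg_iff_of_card_ker`,
`card_ker_of_silentEvenCfg` + the transfers of §2–§3).
[cite: TianYuanZhang2017, Thm. 1.2 (n ≡ 6 (mod 8))] [cite: HeathBrown1994SelmerCongruentII, Appendix (Monsky), typescript p. 41 L20–L36] [cite: LiMa2008, Thm. 0.4] -/
theorem selmerRankOne_and_even_genusSum₂'_iff_silent (hR : redeiReichardt_fourTwoCard_classGroup)
    (hp : ∀ i, (p i).Prime) (hinj : Function.Injective p) (h8 : (2 * ∏ i, p i) % 8 = 6) :
    (monskySelmerRankEven p = 1 ∧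
      Even (genusSum₂' (2 * ∏ i, p i) fun d => genusClassNumber (GenusField d))) ↔
      silentEvenCfg (fun i => p i % 8) (fun a b => kroneckerBit (p b) (p a)) = true := by
  have hp2 := ne_two_of_two_mul_prod_mod_eight_six p h8
  obtain ⟨r₀, r₁, r₂, ⟨e₀, e₁, e₂⟩, hRfun, hBfun⟩ := cfg_three_eq_betaOf p hp hp2 hinj
  have h4 : (r₀.val * r₁.val * r₂.val) % 4 = 3 := by
    rw [e₀, e₁, e₂]; exact cfg_prod_mod_four_of_two_mul p h8
  rw [monskySelmerRankEven_eq_one_iff_card_ker, card_ker_monskyMatrixEven_eq_cfg p hp hp2 hinj,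
    ← ZMod.natCast_eq_zero_iff_even, natCast_genusSum₂'_two_mul_three_eq_cfg p hR hp hp2 hinj h8, hRfun,
    hBfun]
  constructor
  · rintro ⟨hk, hσ⟩
    exact (evenSigmaCfg_iff_of_card_ker r₀ r₁ r₂ _ _ _ h4 hk).mp hσ
  · intro hs
    exact card_ker_and_evenSigmaCfg_of_silent r₀ r₁ r₂ _ _ _ h4 hs

/-- **DOOR B6 ON THE LOUD CONFIGURATIONS (even `ω(m) = 3`) AS ONE THEOREM.** For distinct primes
`p₀, p₁, p₂` with `n = 2p₀p₁p₂ ≡ 6 (mod 8)`, `s(n) = 1`, and configuration NOT a registered silent key: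
`ord_{s=1} L(E_n, s) = 1`, rank `1`, `Ш(E_n)[2^∞] = 0` and `BSD(E_n, 2)` — modulo `hTYZ`, `hGZK`, `hMe`,
`hR`; the genus input `Σ₂′(n)` odd is AUTOMATIC on the `128` loud configurations (census).
[cite: TianYuanZhang2017, Thm. 1.2, Thm. 3.5 and §1 (1.1)]
[cite: HeathBrown1994SelmerCongruentII, Appendix (Monsky), typescript p. 41 L20–L36]
[cite: Miller2011LMS, Def. 1.1 (arXiv:1010.2431 p. 3)] -/
theorem rankOne_sha_bsdp_two_congruentNumberCurve_two_mul_three_of_not_silent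
    (hTYZ : tyz_genusPointData) (hGZK : rank_eq_analyticRank_of_analyticRank_le_one)
    (hMe : monsky_card_selmerGroup_two_even) (hR : redeiReichardt_fourTwoCard_classGroup)
    (hp : ∀ i, (p i).Prime) (hinj : Function.Injective p) {n : ℕ} (hn : 2 * ∏ i, p i = n)
    (h8 : n % 8 = 6) (hs : monskySelmerRankEven p = 1)
    (hns : silentEvenCfg (fun i => p i % 8) (fun a b => kroneckerBit (p b) (p a)) = false) :
    (congruentNumberCurve n).analyticRank = 1 ∧ (congruentNumberCurve n).mordellWeilRank = 1 ∧
      AddCommGroup.primaryComponent (congruentNumberCurve n).sha 2 = ⊥ ∧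
      BSDp (congruentNumberCurve n) 2 := by
  have h8' : (2 * ∏ i, p i) % 8 = 6 := by rw [hn]; exact h8
  have hp2 := ne_two_of_two_mul_prod_mod_eight_six p h8'
  have hodd : ∀ i, Odd (p i) := fun i => (hp i).odd_of_ne_two (hp2 i)
  obtain ⟨r₀, r₁, r₂, ⟨e₀, e₁, e₂⟩, hRfun, hBfun⟩ := cfg_three_eq_betaOf p hp hp2 hinj
  have h4 : (r₀.val * r₁.val * r₂.val) % 4 = 3 := by
    rw [e₀, e₁, e₂]; exact cfg_prod_mod_four_of_two_mul p h8'
  have hk : Fintype.card {v : Fin 3 ⊕ Fin 3 → ZMod 2 // monskyMatrixEven p *ᵥ v = 0} = 2 :=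
    (monskySelmerRankEven_eq_one_iff_card_ker p).mp hs
  have hkc := hk
  rw [card_ker_monskyMatrixEven_eq_cfg p hp hp2 hinj, hRfun, hBfun] at hkc
  rw [hRfun, hBfun] at hns
  have hσ := evenSigmaCfg_eq_one_of_card_ker_of_not_silent r₀ r₁ r₂ _ _ _ h4 hkc hns
  have hgen : Odd (genusSum₂' n fun d => genusClassNumber (GenusField d)) := by
    rw [← ZMod.natCast_eq_one_iff_odd, ← hn, natCast_genusSum₂'_two_mul_three_eq_cfg p hR hp hp2 hinj h8',
      hRfun, hBfun]
    exact hσ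
  exact rankOne_sha_bsdp_two_congruentNumberCurve_of_genusPointData_six p hTYZ hGZK hMe hp hodd hinj hn
    h8 (fun i j => addLegendreSym (p j) (p i)) (fun i => addLegendreSym 2 (p i))
    (fun i => addLegendreSym (-1) (p i)) (fun _ _ => rfl) (fun _ => rfl) (fun _ => rfl) hk hgen

end Door

/-! ## §5 SENTENCES: the even C-P2-2 clause at `ℓ = 3` in genus currency ⟺ in key currency; the EVEN
RUNG THREE of the uniform law is EXACTLY the key sentence (conjectures stated inline; nothing assumed) -/

section Sentences

/-- **Genus currency ⟺ key currency** (mod Rédei–Reichardt). The left side is typer GEN 16's draft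
(P1) `CongruentSilentEvenThreePrimesBSDTwo` = GEN 20's `CongruentSilentEvenBSDTwoAt 3`, VERBATIM (the even
C-P2-2 clause at `ℓ = 3`: `s(n) = 1`, `Σ₂′(n)` even ⟹ `r_an = 1 ∧ BSD₂`); the right side asks the same
conclusion on the THIRTEEN REGISTERED SILENT KEYS, read on residues and Legendre symbols only
(`silentEvenCfg`, no class group). Neither side is asserted.
[cite: TianYuanZhang2017, Thm. 1.2 (n ≡ 6 (mod 8))] [cite: LiMa2008, Thm. 0.4] -/
theorem congruentSilentEvenThree_iff_keys (hR : redeiReichardt_fourTwoCard_classGroup) :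
    (∀ p : Fin 3 → ℕ, (∀ i, (p i).Prime) → Function.Injective p → (2 * ∏ i, p i) % 8 = 6 →
      monskySelmerRankEven p = 1 →
      Even (genusSum₂' (2 * ∏ i, p i) fun d => genusClassNumber (GenusField d)) →
        (congruentNumberCurve (2 * ∏ i, p i)).analyticRank = 1 ∧
          BSDp (congruentNumberCurve (2 * ∏ i, p i)) 2) ↔
    (∀ p : Fin 3 → ℕ, (∀ i, (p i).Prime) → Function.Injective p → (2 * ∏ i, p i) % 8 = 6 →
      silentEvenCfg (fun i => p i % 8) (fun a b => kroneckerBit (p b) (p a)) = true →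
        (congruentNumberCurve (2 * ∏ i, p i)).analyticRank = 1 ∧
          BSDp (congruentNumberCurve (2 * ∏ i, p i)) 2) := by
  constructor
  · intro h p hp hinj h8 hs
    obtain ⟨h1, h2⟩ := (selmerRankOne_and_even_genusSum₂'_iff_silent p hR hp hinj h8).mpr hs
    exact h p hp hinj h8 h1 h2
  · intro h p hp hinj h8 h1 h2
    exact h p hp hinj h8 ((selmerRankOne_and_even_genusSum₂'_iff_silent p hR hp hinj h8).mp ⟨h1, h2⟩)

/-- **EVEN RUNG THREE ⟹ the key sentence, with NO named fact**: the `k = 3` rung of the uniform even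
law (GEN 20's `CongruentEvenBSDTwoAt 3`, VERBATIM: `s(n) = 1 ⟹ r_an = 1 ∧ BSD₂` for `n = 2p₀p₁p₂ ≡ 6`)
implies the conclusion on every registered silent key (`s = 1` there by the census).
[cite: HeathBrown1994SelmerCongruentII, Appendix (Monsky), typescript p. 41 L20–L36] -/
theorem keys_of_evenRung_three
    (h : ∀ p : Fin 3 → ℕ, (∀ i, (p i).Prime) → Function.Injective p → (2 * ∏ i, p i) % 8 = 6 →
      monskySelmerRankEven p = 1 →
        (congruentNumberCurve (2 * ∏ i, p i)).analyticRank = 1 ∧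
          BSDp (congruentNumberCurve (2 * ∏ i, p i)) 2) :
    ∀ p : Fin 3 → ℕ, (∀ i, (p i).Prime) → Function.Injective p → (2 * ∏ i, p i) % 8 = 6 →
      silentEvenCfg (fun i => p i % 8) (fun a b => kroneckerBit (p b) (p a)) = true →
        (congruentNumberCurve (2 * ∏ i, p i)).analyticRank = 1 ∧
          BSDp (congruentNumberCurve (2 * ∏ i, p i)) 2 :=
  fun p hp hinj h8 hs => h p hp hinj h8 (monskySelmerRankEven_eq_one_of_silent p hp hinj h8 hs)

/-- **The key sentence ⟹ EVEN RUNG THREE** (mod `hTYZ`, `hGZK`, `hMe`, `hR`): on a loud configuration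
DOOR B6 gives the rung's conclusion, on a silent one the key sentence does.
[cite: TianYuanZhang2017, Thm. 1.2, Thm. 3.5 and §1 (1.1)] [cite: Miller2011LMS, Def. 1.1 (arXiv:1010.2431 p. 3)] -/
theorem evenRung_three_of_keys (hTYZ : tyz_genusPointData)
    (hGZK : rank_eq_analyticRank_of_analyticRank_le_one) (hMe : monsky_card_selmerGroup_two_even)
    (hR : redeiReichardt_fourTwoCard_classGroup)
    (h : ∀ p : Fin 3 → ℕ, (∀ i, (p i).Prime) → Function.Injective p → (2 * ∏ i, p i) % 8 = 6 →
      silentEvenCfg (fun i => p i % 8) (fun a b => kroneckerBit (p b) (p a)) = true →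
        (congruentNumberCurve (2 * ∏ i, p i)).analyticRank = 1 ∧
          BSDp (congruentNumberCurve (2 * ∏ i, p i)) 2) :
    ∀ p : Fin 3 → ℕ, (∀ i, (p i).Prime) → Function.Injective p → (2 * ∏ i, p i) % 8 = 6 →
      monskySelmerRankEven p = 1 →
        (congruentNumberCurve (2 * ∏ i, p i)).analyticRank = 1 ∧
          BSDp (congruentNumberCurve (2 * ∏ i, p i)) 2 := by
  intro p hp hinj h8 hs
  by_cases hsil : silentEvenCfg (fun i => p i % 8) (fun a b => kroneckerBit (p b) (p a)) = true
  · exact h p hp hinj h8 hsil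
  · have hns : silentEvenCfg (fun i => p i % 8) (fun a b => kroneckerBit (p b) (p a)) = false := by
      simpa using hsil
    have hd := rankOne_sha_bsdp_two_congruentNumberCurve_two_mul_three_of_not_silent p hTYZ hGZK hMe hR
      hp hinj rfl h8 hs hns
    exact ⟨hd.1, hd.2.2.2⟩

/-- **EVEN RUNG THREE ⟺ THE KEY SENTENCE** (mod `hTYZ`, `hGZK`, `hMe`, `hR`; ⟹ uses none of them): below
the blind line the `k = 3` rung of the uniform even Monsky law is EXACTLY the even C-P2-2 clause at
`ℓ = 3`, here in its elementary key currency — the even twin of typer GEN 22's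
`oddRung_three_iff_silentFiveSevenSeven`. Neither side is asserted.
[cite: TianYuanZhang2017, Thm. 1.2, Thm. 3.5 and §1 (1.1)] [cite: HeathBrown1994SelmerCongruentII, Appendix (Monsky), typescript p. 41 L20–L36] -/
theorem evenRung_three_iff_keys (hTYZ : tyz_genusPointData)
    (hGZK : rank_eq_analyticRank_of_analyticRank_le_one) (hMe : monsky_card_selmerGroup_two_even)
    (hR : redeiReichardt_fourTwoCard_classGroup) :
    (∀ p : Fin 3 → ℕ, (∀ i, (p i).Prime) → Function.Injective p → (2 * ∏ i, p i) % 8 = 6 →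
      monskySelmerRankEven p = 1 →
        (congruentNumberCurve (2 * ∏ i, p i)).analyticRank = 1 ∧
          BSDp (congruentNumberCurve (2 * ∏ i, p i)) 2) ↔
    (∀ p : Fin 3 → ℕ, (∀ i, (p i).Prime) → Function.Injective p → (2 * ∏ i, p i) % 8 = 6 →
      silentEvenCfg (fun i => p i % 8) (fun a b => kroneckerBit (p b) (p a)) = true →
        (congruentNumberCurve (2 * ∏ i, p i)).analyticRank = 1 ∧
          BSDp (congruentNumberCurve (2 * ∏ i, p i)) 2) :=
  ⟨keys_of_evenRung_three, evenRung_three_of_keys hTYZ hGZK hMe hR⟩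

end Sentences

end Summit.BirchSwinnertonDyer.Rank1Residual.P2

end
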